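import Literature.Analysis.FluidPDE.NSWeakStrongUniquenessProofs
import HarnessLib

/-!
# Forward DSS solutions: the Gagliardo–Nirenberg step of Bradshaw–Tsai 2019, p. 9

Analysis/FluidPDE proof file (theorems only) in the decomposition of
`Literature.Analysis.FluidPDE.bradshawTsai2019_prop_3_1` (Bradshaw–Tsai, Analysis & PDE 12
(2019) = arXiv:1801.08060, Prop. 3.1; the remaining analytic input is the a priori estimate
(3.12), cf. `bradshawTsai2019_prop_3_1_approximation` in `ForwardDSSLocalEnergyLimit`). The cubic
term of the local energy equality is controlled in print by

> "By the Gagliardo-Nirenberg inequality and re-scaling (3.6), we have, for any `s > 0`, that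
> `‖φ^{1/2}v_ε(s)‖_{L³} ≤ C‖∇⊗(φ^{1/2}v_ε)‖_{L²}^{1/2} ‖φ^{1/2}v_ε‖_{L²}^{1/2}(s)
>  ≤ C(λ)(α̃_ε(s)^{1/2} + ‖φ^{1/2}∇v_ε(s)‖_{L²})^{1/2} (α̃_ε(s))^{1/4}`.
> Hence, for any `γ > 0`,
> `‖φ^{1/2}v_ε(s)‖³_{L³} ≤ C(λ)(γ⁻³α̃_ε(s)³ + γα̃_ε(s) + γ‖φ^{1/2}∇v_ε(s)‖₂²)`." (p. 9)

with `φ = χ²(|x|)`, `χ = 1` on `[0,1]`, `χ = 0` on `[λ,∞)`, so that `φ^{1/2} = χ(|x|)` is a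
smooth cut-off supported in `B_λ` and `‖φ^{1/2}v_ε(s)‖²_{L²} ≤ ‖v_ε(s)‖²_{L²(B_λ)} (≤ λα̃_ε(s)` by
(3.6)). This file proves the functional inequality behind this display, for a fixed time slice
and before the re-scaling (3.6) (which is `ForwardDSSLocalEnergyScaling`): on a `3`-dimensional
real inner product space, for a `C¹` cut-off `χ` with `|χ| ≤ 1`, `‖Dχ‖ ≤ M`, `χ = 0` off `B_R`,
and every `γ ∈ (0, ∞)` there is `C = C(χ, γ) < ∞` with

  `∫ |χu|³ ≤ C (A³ + A) + γ ∫ χ²|Du|²`, `A = ∫_{B_R} |u|²`,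

for every `C¹` field `u` (`lintegral_enorm_cutoff_smul_rpow_three_le`). Ingredients, all in the
`ℝ≥0∞` vocabulary: the interpolation `∫|f|³ ≤ (∫|f|²)^{3/4}(∫|f|⁶)^{1/4}` (Hölder,
`lintegral_enorm_rpow_three_le_interpolation`); the Sobolev inequality `H¹(ℝ³) ⊂ L⁶(ℝ³)` for `C¹`
fields in `L²` (the accepted `eLpNorm_six_le_eLpNorm_fderiv_two`, `SobolevWholeSpace`, from
Mathlib's Gagliardo–Nirenberg–Sobolev inequality), here raised to the power `3/2`
(`lintegral_enorm_rpow_six_rpow_le`); the Leibniz bound `‖D(χu)‖ ≤ M|u| + |χ| |Du|` with the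
operator norm dominated by the Frobenius norm (accepted `opNorm_le_sqrt_frobeniusNormSq`,
`NSWeakStrongUniquenessProofs`); and the scalar inequalities `(a+b)^{3/4} ≤ a^{3/4} + b^{3/4}`,
Young `cA^{3/4}G^{3/4} ≤ γG + c⁴γ⁻³A³`, `A^{3/2} ≤ A + A³`.

## References

* Z. Bradshaw, T.-P. Tsai, Analysis & PDE 12 (2019) 1943–1962 = arXiv:1801.08060, §3, proof of
  Prop. 3.1, the Gagliardo–Nirenberg display on p. 9 [BradshawTsai2019].
* L. C. Evans, *Partial Differential Equations* (2010), §5.6.1 (Gagliardo–Nirenberg–Sobolev).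
-/

noncomputable section

open MeasureTheory Set Function Filter Metric Module
open scoped NNReal ENNReal Topology

namespace Literature.Analysis.FluidPDE

namespace BradshawTsai2019

/-! ## Scalar inequalities in `ℝ≥0∞` -/

/-- `t^{3/2} ≤ t + t³` on `[0, ∞]` ("`α^{3/2} ≤ α + α³` for `α > 0`", Bradshaw–Tsai 2019,
p. 10). [folklore] -/
theorem rpow_three_halves_le_self_add_pow_three (t : ℝ≥0∞) : t ^ (3 / 2 : ℝ) ≤ t + t ^ 3 := by
  rcases le_or_gt t 1 with ht | ht
  · calc t ^ (3 / 2 : ℝ) ≤ t ^ (1 : ℝ) :=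
          ENNReal.rpow_le_rpow_of_exponent_ge ht (by norm_num)
      _ = t := ENNReal.rpow_one t
      _ ≤ t + t ^ 3 := le_self_add
  · calc t ^ (3 / 2 : ℝ) ≤ t ^ (3 : ℝ) :=
          ENNReal.rpow_le_rpow_of_exponent_le ht.le (by norm_num)
      _ = t ^ 3 := by rw [show (3 : ℝ) = ((3 : ℕ) : ℝ) by norm_num, ENNReal.rpow_natCast]
      _ ≤ t + t ^ 3 := le_add_self

/-- **Young's inequality with `ε`** in the product form used on p. 9: for `γ ∈ (0,∞)`,
`c A^{3/4} G^{3/4} ≤ γ G + c⁴ γ⁻³ A³` (Mathlib's `ENNReal.young_inequality` with exponents `4/3`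
and `4` applied to `(γ^{3/4}G^{3/4}) · (cγ^{-3/4}A^{3/4})`). The tree's
`ENNReal.mul_rpow_three_quarters_le` (`NSUniqueness2DParts`: `A B^{3/4} ≤ εB + ε⁻³A⁴`) is the
same inequality after the substitution `A ↦ cA^{3/4}`; it is restated in the present form rather
than imported so as not to pull the `𝕋²` uniqueness chain into the DSS files. [folklore] -/
theorem mul_rpow_three_quarters_le (c A G : ℝ≥0∞) {γ : ℝ≥0∞} (hγ0 : γ ≠ 0) (hγt : γ ≠ ⊤) :
    c * A ^ (3 / 4 : ℝ) * G ^ (3 / 4 : ℝ) ≤ γ * G + c ^ 4 * (γ⁻¹) ^ 3 * A ^ 3 := by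
  have hpq : (4 / 3 : ℝ).HolderConjugate 4 := Real.holderConjugate_iff.2 ⟨by norm_num, by norm_num⟩
  set s : ℝ≥0∞ := γ ^ (3 / 4 : ℝ) with hs
  have hs0 : s ≠ 0 := by
    rw [hs, Ne, ENNReal.rpow_eq_zero_iff]; push Not
    exact ⟨fun h => absurd h hγ0, fun h => absurd h hγt⟩
  have hst : s ≠ ⊤ := ENNReal.rpow_ne_top_of_nonneg (by norm_num) hγt
  set a : ℝ≥0∞ := s * G ^ (3 / 4 : ℝ) with ha
  set b : ℝ≥0∞ := c * s⁻¹ * A ^ (3 / 4 : ℝ) with hb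
  have hab : c * A ^ (3 / 4 : ℝ) * G ^ (3 / 4 : ℝ) = a * b := by
    rw [ha, hb]
    calc c * A ^ (3 / 4 : ℝ) * G ^ (3 / 4 : ℝ)
        = c * (s * s⁻¹) * A ^ (3 / 4 : ℝ) * G ^ (3 / 4 : ℝ) := by
          rw [ENNReal.mul_inv_cancel hs0 hst, mul_one]
      _ = s * G ^ (3 / 4 : ℝ) * (c * s⁻¹ * A ^ (3 / 4 : ℝ)) := by ring
  rw [hab]
  refine (ENNReal.young_inequality a b hpq).trans (add_le_add ?_ ?_)
  · -- `a^{4/3} / (4/3) ≤ γ G`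
    have h1 : a ^ (4 / 3 : ℝ) = γ * G := by
      rw [ha, ENNReal.mul_rpow_of_nonneg _ _ (by norm_num), hs, ← ENNReal.rpow_mul,
        ← ENNReal.rpow_mul]
      norm_num
    rw [h1]
    exact ENNReal.div_le_of_le_mul (le_mul_of_one_le_right' (by
      rw [← ENNReal.ofReal_one]; exact ENNReal.ofReal_le_ofReal (by norm_num)))
  · -- `b⁴ / 4 ≤ c⁴ γ⁻³ A³`
    have h2 : b ^ (4 : ℝ) = c ^ 4 * (γ⁻¹) ^ 3 * A ^ 3 := by
      have e1 : (A ^ (3 / 4 : ℝ)) ^ (4 : ℝ) = A ^ 3 := by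
        rw [← ENNReal.rpow_mul, show (3 / 4 * 4 : ℝ) = ((3 : ℕ) : ℝ) by norm_num,
          ENNReal.rpow_natCast]
      have e2 : (s⁻¹) ^ (4 : ℝ) = (γ⁻¹) ^ 3 := by
        rw [hs, ← ENNReal.rpow_neg, ← ENNReal.rpow_mul,
          show (-(3 / 4) * 4 : ℝ) = -((3 : ℕ) : ℝ) by norm_num, ENNReal.rpow_neg,
          ENNReal.rpow_natCast, ENNReal.inv_pow]
      have e3 : c ^ (4 : ℝ) = c ^ 4 := by
        rw [show (4 : ℝ) = ((4 : ℕ) : ℝ) by norm_num, ENNReal.rpow_natCast]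
      rw [hb, ENNReal.mul_rpow_of_nonneg _ _ (by norm_num),
        ENNReal.mul_rpow_of_nonneg _ _ (by norm_num), e1, e2, e3]
    rw [h2]
    exact ENNReal.div_le_of_le_mul (le_mul_of_one_le_right' (by
      rw [← ENNReal.ofReal_one]; exact ENNReal.ofReal_le_ofReal (by norm_num)))

/-! ## Interpolation and the Sobolev inequality in `ℝ≥0∞` form -/

section Sobolev

variable {X : Type*} [MeasurableSpace X]
variable {F : Type*} [NormedAddCommGroup F]

/-- **Interpolation** `∫ |f|³ ≤ (∫ |f|²)^{3/4} (∫ |f|⁶)^{1/4}` (Hölder with exponents `4/3`, `4` on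
`|f|^{3/2} · |f|^{3/2}`; the first inequality of the Gagliardo–Nirenberg display, p. 9). [folklore] -/
theorem lintegral_enorm_rpow_three_le_interpolation (μ : Measure X) {f : X → F}
    (hf : AEStronglyMeasurable f μ) :
    ∫⁻ x, ‖f x‖ₑ ^ (3 : ℝ) ∂μ ≤
      (∫⁻ x, ‖f x‖ₑ ^ (2 : ℝ) ∂μ) ^ (3 / 4 : ℝ) * (∫⁻ x, ‖f x‖ₑ ^ (6 : ℝ) ∂μ) ^ (1 / 4 : ℝ) := by
  have hpq : (4 / 3 : ℝ).HolderConjugate 4 := Real.holderConjugate_iff.2 ⟨by norm_num, by norm_num⟩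
  have hm : AEMeasurable (fun x => ‖f x‖ₑ ^ (3 / 2 : ℝ)) μ := hf.enorm.pow_const _
  have h := ENNReal.lintegral_mul_le_Lp_mul_Lq μ hpq hm hm
  have e1 : ∀ x, ((fun x => ‖f x‖ₑ ^ (3 / 2 : ℝ)) * fun x => ‖f x‖ₑ ^ (3 / 2 : ℝ)) x =
      ‖f x‖ₑ ^ (3 : ℝ) := fun x => by
    rw [Pi.mul_apply, ← ENNReal.rpow_add_of_nonneg _ _ (by norm_num) (by norm_num)]; norm_num
  have e2 : ∀ x, (‖f x‖ₑ ^ (3 / 2 : ℝ)) ^ (4 / 3 : ℝ) = ‖f x‖ₑ ^ (2 : ℝ) := fun x => by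
    rw [← ENNReal.rpow_mul]; norm_num
  have e3 : ∀ x, (‖f x‖ₑ ^ (3 / 2 : ℝ)) ^ (4 : ℝ) = ‖f x‖ₑ ^ (6 : ℝ) := fun x => by
    rw [← ENNReal.rpow_mul]; norm_num
  simp_rw [e1, e2, e3] at h
  rw [show (1 / (4 / 3) : ℝ) = 3 / 4 by norm_num] at h
  exact h

variable {E : Type*} [NormedAddCommGroup E] [InnerProductSpace ℝ E] [FiniteDimensional ℝ E]
  [MeasurableSpace E] [BorelSpace E]
variable {F' : Type*} [NormedAddCommGroup F'] [NormedSpace ℝ F'] [FiniteDimensional ℝ F']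

/-- **`H¹(ℝ³) ⊂ L⁶(ℝ³)`, power `3/2`**: for a `C¹` field `u ∈ L²` on a `3`-dimensional space,
`(∫ |u|⁶)^{1/4} ≤ K^{3/2} (∫ ‖Du‖²)^{3/4}`, `K` the constant of the accepted
`eLpNorm_six_le_eLpNorm_fderiv_two` (Mathlib's Gagliardo–Nirenberg–Sobolev constant). [folklore] -/
theorem lintegral_enorm_rpow_six_rpow_le (μ : Measure E) [μ.IsAddHaarMeasure]
    (hE : finrank ℝ E = 3) {u : E → F'} (hu : ContDiff ℝ 1 u) (hu2 : eLpNorm u 2 μ < ⊤) :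
    (∫⁻ x, ‖u x‖ₑ ^ (6 : ℝ) ∂μ) ^ (1 / 4 : ℝ) ≤
      (SNormLESNormFDerivOfEqConst F' μ 2 : ℝ≥0∞) ^ (3 / 2 : ℝ) *
        (∫⁻ x, ‖fderiv ℝ u x‖ₑ ^ (2 : ℝ) ∂μ) ^ (3 / 4 : ℝ) := by
  have h := eLpNorm_six_le_eLpNorm_fderiv_two μ hE hu hu2
  rw [eLpNorm_eq_lintegral_rpow_enorm_toReal (by norm_num) (by norm_num),
    eLpNorm_eq_lintegral_rpow_enorm_toReal (by norm_num) (by norm_num)] at h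
  simp only [ENNReal.toReal_ofNat] at h
  have h' := ENNReal.rpow_le_rpow h (by norm_num : (0 : ℝ) ≤ 3 / 2)
  rw [← ENNReal.rpow_mul, ENNReal.mul_rpow_of_nonneg _ _ (by norm_num), ← ENNReal.rpow_mul] at h'
  rw [show (1 / 6 * (3 / 2) : ℝ) = 1 / 4 by norm_num, show (1 / 2 * (3 / 2) : ℝ) = 3 / 4 by norm_num]
    at h'
  exact h'

end Sobolev

/-! ## The localized Gagliardo–Nirenberg bound with a cut-off -/

section Cutoff

variable {E : Type*} [NormedAddCommGroup E] [InnerProductSpace ℝ E] [FiniteDimensional ℝ E]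
  [MeasurableSpace E] [BorelSpace E]
variable {F' : Type*} [NormedAddCommGroup F'] [InnerProductSpace ℝ F'] [FiniteDimensional ℝ F']

omit [MeasurableSpace E] [BorelSpace E] [FiniteDimensional ℝ F'] in
/-- **Leibniz bound for a cut-off product**, squared, in `ℝ≥0∞`: for `C¹` maps `χ` (scalar,
`‖Dχ‖ ≤ M`) and `u`, `‖D(χu)(x)‖² ≤ 2M²‖u(x)‖² + 2χ(x)²|Du(x)|²` (`D(χu) = χ Du + Dχ ⊗ u`, and the
operator norm of `Du` is dominated by its Frobenius norm `|Du|`). [folklore] -/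
theorem enorm_fderiv_smul_rpow_two_le {χ : E → ℝ} (hχ : ContDiff ℝ 1 χ) {M : ℝ}
    (hM : ∀ x, ‖fderiv ℝ χ x‖ ≤ M) {u : E → F'} (hu : ContDiff ℝ 1 u) (x : E) :
    ‖fderiv ℝ (fun y => χ y • u y) x‖ₑ ^ (2 : ℝ) ≤
      2 * ENNReal.ofReal (M ^ 2) * ‖u x‖ₑ ^ 2 +
        2 * ENNReal.ofReal (χ x ^ 2 * frobeniusNormSq (fderiv ℝ u x)) := by
  have hM0 : 0 ≤ M := (norm_nonneg _).trans (hM x)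
  have hdχ : DifferentiableAt ℝ χ x := (hχ.differentiable one_ne_zero).differentiableAt
  have hdu : DifferentiableAt ℝ u x := (hu.differentiable one_ne_zero).differentiableAt
  rw [fderiv_fun_smul hdχ hdu]
  -- real-valued bound `‖D(χu)‖ ≤ |χ| √|Du|² + M ‖u‖`
  have hreal : ‖χ x • fderiv ℝ u x + (fderiv ℝ χ x).smulRight (u x)‖ ≤
      |χ x| * Real.sqrt (frobeniusNormSq (fderiv ℝ u x)) + M * ‖u x‖ := by
    refine (norm_add_le _ _).trans (add_le_add ?_ ?_)
    · rw [norm_smul, Real.norm_eq_abs]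
      exact mul_le_mul_of_nonneg_left (opNorm_le_sqrt_frobeniusNormSq _) (abs_nonneg _)
    · rw [ContinuousLinearMap.norm_smulRight_apply]
      exact mul_le_mul_of_nonneg_right (hM x) (norm_nonneg _)
  -- square it: `(a + b)² ≤ 2a² + 2b²`
  have hsq : ‖χ x • fderiv ℝ u x + (fderiv ℝ χ x).smulRight (u x)‖ ^ 2 ≤
      2 * (M ^ 2 * ‖u x‖ ^ 2) + 2 * (χ x ^ 2 * frobeniusNormSq (fderiv ℝ u x)) := by
    have hF := frobeniusNormSq_nonneg (fderiv ℝ u x)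
    set a : ℝ := |χ x| * Real.sqrt (frobeniusNormSq (fderiv ℝ u x)) with ha
    set b : ℝ := M * ‖u x‖ with hb
    have h1 : ‖χ x • fderiv ℝ u x + (fderiv ℝ χ x).smulRight (u x)‖ ^ 2 ≤ (a + b) ^ 2 :=
      pow_le_pow_left₀ (norm_nonneg _) hreal 2
    have h2 : (a + b) ^ 2 ≤ 2 * a ^ 2 + 2 * b ^ 2 := by nlinarith [sq_nonneg (a - b)]
    have h3 : 2 * a ^ 2 + 2 * b ^ 2 =
        2 * (M ^ 2 * ‖u x‖ ^ 2) + 2 * (χ x ^ 2 * frobeniusNormSq (fderiv ℝ u x)) := by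
      rw [ha, hb, mul_pow, mul_pow, sq_abs, Real.sq_sqrt hF]; ring
    linarith
  -- move to `ℝ≥0∞`
  calc ‖χ x • fderiv ℝ u x + (fderiv ℝ χ x).smulRight (u x)‖ₑ ^ (2 : ℝ)
      = ENNReal.ofReal (‖χ x • fderiv ℝ u x + (fderiv ℝ χ x).smulRight (u x)‖ ^ 2) := by
        rw [← ofReal_norm, ENNReal.ofReal_rpow_of_nonneg (norm_nonneg _) zero_le_two,
          Real.rpow_two]
    _ ≤ ENNReal.ofReal (2 * (M ^ 2 * ‖u x‖ ^ 2) + 2 * (χ x ^ 2 * frobeniusNormSq (fderiv ℝ u x))) :=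
        ENNReal.ofReal_le_ofReal hsq
    _ = 2 * ENNReal.ofReal (M ^ 2) * ‖u x‖ₑ ^ 2 +
          2 * ENNReal.ofReal (χ x ^ 2 * frobeniusNormSq (fderiv ℝ u x)) := by
        rw [ENNReal.ofReal_add (by positivity) (by
            exact mul_nonneg zero_le_two (mul_nonneg (sq_nonneg _) (frobeniusNormSq_nonneg _))),
          ENNReal.ofReal_mul zero_le_two, ENNReal.ofReal_mul zero_le_two,
          ENNReal.ofReal_mul (sq_nonneg _), ENNReal.ofReal_ofNat, ← ofReal_norm,
          ENNReal.ofReal_pow (norm_nonneg _), mul_assoc]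

/-- **The localized Gagliardo–Nirenberg bound with a cut-off** (the display on p. 9 of
Bradshaw–Tsai 2019, before the re-scaling (3.6)). Let `dim E = 3`, let `χ : E → ℝ` be `C¹` with
`|χ| ≤ 1`, `‖Dχ‖ ≤ M` and `χ = 0` outside `B_R`, and let `0 < γ < ∞`. There is a constant `C < ∞`
(depending on `χ` through `M`, on `γ`, and on the Sobolev constant) such that for every `C¹`
field `u : E → F'`,
`∫ |χu|³ ≤ C ((∫_{B_R}|u|²)³ + ∫_{B_R}|u|²) + γ ∫ χ²|Du|²`
("`‖φ^{1/2}v_ε(s)‖³_{L³} ≤ C(λ)(γ⁻³α̃³ + γα̃ + γ‖φ^{1/2}∇v_ε(s)‖₂²)`" with `φ^{1/2} = χ`, once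
`‖v_ε(s)‖²_{L²(B_λ)} ≤ λα̃_ε(s)` is inserted). Proof: interpolation, Sobolev, the Leibniz bound (the
derivative of `χu` vanishes off the closed ball, and the sphere is Lebesgue-null), then
`(a+b)^{3/4} ≤ a^{3/4} + b^{3/4}`, Young, and `A^{3/2} ≤ A + A³`. [cite: BradshawTsai2019, §3 p. 9 (Gagliardo–Nirenberg step)] -/
theorem lintegral_enorm_cutoff_smul_rpow_three_le (hE : finrank ℝ E = 3) {χ : E → ℝ}
    (hχ : ContDiff ℝ 1 χ) (hχ1 : ∀ x, |χ x| ≤ 1) {M : ℝ} (hM : ∀ x, ‖fderiv ℝ χ x‖ ≤ M)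
    {R : ℝ} (hχR : ∀ x, R ≤ ‖x‖ → χ x = 0) {γ : ℝ≥0∞} (hγ0 : γ ≠ 0) (hγt : γ ≠ ⊤) :
    ∃ C : ℝ≥0∞, C ≠ ⊤ ∧ ∀ u : E → F', ContDiff ℝ 1 u →
      ∫⁻ x, ‖χ x • u x‖ₑ ^ (3 : ℝ) ≤
        C * ((∫⁻ x in ball (0 : E) R, ‖u x‖ₑ ^ 2) ^ 3 + ∫⁻ x in ball (0 : E) R, ‖u x‖ₑ ^ 2) +
          γ * ∫⁻ x, ENNReal.ofReal (χ x ^ 2 * frobeniusNormSq (fderiv ℝ u x)) := by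
  haveI : Nontrivial E := Module.nontrivial_of_finrank_pos (R := ℝ) (by rw [hE]; norm_num)
  -- the constants
  set K : ℝ≥0∞ := (SNormLESNormFDerivOfEqConst F' (volume : Measure E) 2 : ℝ≥0∞) ^ (3 / 2 : ℝ)
    with hK
  set M₂ : ℝ≥0∞ := 2 * ENNReal.ofReal (M ^ 2) with hM₂
  set c : ℝ≥0∞ := K * (2 : ℝ≥0∞) ^ (3 / 4 : ℝ) with hc
  have hKt : K ≠ ⊤ := ENNReal.rpow_ne_top_of_nonneg (by norm_num) ENNReal.coe_ne_top
  have hM₂t : M₂ ≠ ⊤ := ENNReal.mul_ne_top ENNReal.ofNat_ne_top ENNReal.ofReal_ne_top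
  have hct : c ≠ ⊤ :=
    ENNReal.mul_ne_top hKt (ENNReal.rpow_ne_top_of_nonneg (by norm_num) ENNReal.ofNat_ne_top)
  refine ⟨K * M₂ ^ (3 / 4 : ℝ) + c ^ 4 * (γ⁻¹) ^ 3, ENNReal.add_ne_top.2
    ⟨ENNReal.mul_ne_top hKt (ENNReal.rpow_ne_top_of_nonneg (by norm_num) hM₂t),
     ENNReal.mul_ne_top (ENNReal.pow_ne_top hct)
      (ENNReal.pow_ne_top (ENNReal.inv_ne_top.2 hγ0))⟩, fun u hu => ?_⟩
  set f : E → F' := fun x => χ x • u x with hf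
  have hfC : ContDiff ℝ 1 f := hχ.smul hu
  set A : ℝ≥0∞ := ∫⁻ x in ball (0 : E) R, ‖u x‖ₑ ^ 2 with hA
  set G : ℝ≥0∞ := ∫⁻ x, ENNReal.ofReal (χ x ^ 2 * frobeniusNormSq (fderiv ℝ u x)) with hG
  -- `f` vanishes outside the open ball, hence has compact support
  have hf0 : ∀ x, x ∉ ball (0 : E) R → f x = 0 := fun x hx => by
    rw [mem_ball_zero_iff, not_lt] at hx
    simp only [hf, hχR x hx, zero_smul]
  have hfsupp : HasCompactSupport f :=
    HasCompactSupport.intro (isCompact_closedBall (0 : E) R) fun x hx =>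
      hf0 x fun h => hx (ball_subset_closedBall h)
  have hf2 : eLpNorm f 2 volume < ⊤ :=
    (hfC.continuous.memLp_of_hasCompactSupport hfsupp).eLpNorm_lt_top
  -- (a) `∫ |f|² ≤ A`
  have hA₂ : ∫⁻ x, ‖f x‖ₑ ^ (2 : ℝ) ≤ A := by
    rw [hA, ← lintegral_indicator measurableSet_ball]
    refine lintegral_mono fun x => ?_
    by_cases hx : x ∈ ball (0 : E) R
    · rw [indicator_of_mem hx, ENNReal.rpow_two, hf]
      simp only
      rw [enorm_smul]
      calc (‖χ x‖ₑ * ‖u x‖ₑ) ^ 2 ≤ (1 * ‖u x‖ₑ) ^ 2 := by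
            gcongr
            rw [Real.enorm_eq_ofReal_abs, ← ENNReal.ofReal_one]
            exact ENNReal.ofReal_le_ofReal (hχ1 x)
        _ = ‖u x‖ₑ ^ 2 := by rw [one_mul]
    · rw [indicator_of_notMem hx, hf0 x hx, enorm_zero, ENNReal.zero_rpow_of_pos two_pos]
  -- (c) `∫ ‖Df‖² ≤ M₂ A + 2 G` (the derivative vanishes off the closed ball; the sphere is null)
  have hD₂ : ∫⁻ x, ‖fderiv ℝ f x‖ₑ ^ (2 : ℝ) ≤ M₂ * A + 2 * G := by
    have hae : ∀ᵐ x ∂(volume : Measure E), ‖fderiv ℝ f x‖ₑ ^ (2 : ℝ) ≤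
        M₂ * (ball (0 : E) R).indicator (fun x => ‖u x‖ₑ ^ 2) x +
          2 * ENNReal.ofReal (χ x ^ 2 * frobeniusNormSq (fderiv ℝ u x)) := by
      have hsph : ∀ᵐ x ∂(volume : Measure E), x ∉ sphere (0 : E) R := by
        rw [ae_iff]
        simp only [not_not, setOf_mem_eq]
        exact Measure.addHaar_sphere volume (0 : E) R
      filter_upwards [hsph] with x hx
      by_cases hxb : x ∈ ball (0 : E) R
      · rw [indicator_of_mem hxb]
        exact enorm_fderiv_smul_rpow_two_le hχ hM hu x
      · -- outside the closed ball `f ≡ 0` near `x`, so `Df(x) = 0`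
        have hxR : R < ‖x‖ := by
          rw [mem_ball_zero_iff, not_lt] at hxb
          rw [mem_sphere_zero_iff_norm] at hx
          exact lt_of_le_of_ne hxb (Ne.symm hx)
        have hloc : f =ᶠ[𝓝 x] fun _ => (0 : F') := by
          have hopen : IsOpen {y : E | R < ‖y‖} := isOpen_lt continuous_const continuous_norm
          filter_upwards [hopen.mem_nhds hxR] with y hy
          exact hf0 y fun h => absurd (mem_ball_zero_iff.1 h) (not_lt.2 hy.le)
        rw [hloc.fderiv_eq, fderiv_const_apply, ← ofReal_norm, norm_zero,
          ENNReal.ofReal_zero, ENNReal.zero_rpow_of_pos two_pos]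
        exact zero_le
    have hmu : Measurable fun x => ‖u x‖ₑ ^ 2 := hu.continuous.enorm.measurable.pow_const 2
    have hmeas : Measurable fun x => M₂ * (ball (0 : E) R).indicator (fun x => ‖u x‖ₑ ^ 2) x :=
      (hmu.indicator measurableSet_ball).const_mul _
    calc ∫⁻ x, ‖fderiv ℝ f x‖ₑ ^ (2 : ℝ)
        ≤ ∫⁻ x, (M₂ * (ball (0 : E) R).indicator (fun x => ‖u x‖ₑ ^ 2) x +
            2 * ENNReal.ofReal (χ x ^ 2 * frobeniusNormSq (fderiv ℝ u x))) := lintegral_mono_ae hae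
      _ = M₂ * A + 2 * G := by
          rw [lintegral_add_left hmeas, lintegral_const_mul _ (hmu.indicator measurableSet_ball),
            lintegral_indicator measurableSet_ball, lintegral_const_mul' _ _ ENNReal.ofNat_ne_top]
  -- (d) interpolation and Sobolev
  have hI : ∫⁻ x, ‖f x‖ₑ ^ (3 : ℝ) ≤ K * A ^ (3 / 4 : ℝ) * (M₂ * A + 2 * G) ^ (3 / 4 : ℝ) := by
    calc ∫⁻ x, ‖f x‖ₑ ^ (3 : ℝ)
        ≤ (∫⁻ x, ‖f x‖ₑ ^ (2 : ℝ)) ^ (3 / 4 : ℝ) * (∫⁻ x, ‖f x‖ₑ ^ (6 : ℝ)) ^ (1 / 4 : ℝ) :=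
          lintegral_enorm_rpow_three_le_interpolation volume hfC.continuous.aestronglyMeasurable
      _ ≤ A ^ (3 / 4 : ℝ) * (K * (∫⁻ x, ‖fderiv ℝ f x‖ₑ ^ (2 : ℝ)) ^ (3 / 4 : ℝ)) :=
          mul_le_mul' (ENNReal.rpow_le_rpow hA₂ (by norm_num))
            (lintegral_enorm_rpow_six_rpow_le volume hE hfC hf2)
      _ ≤ A ^ (3 / 4 : ℝ) * (K * (M₂ * A + 2 * G) ^ (3 / 4 : ℝ)) :=
          mul_le_mul' le_rfl (mul_le_mul' le_rfl (ENNReal.rpow_le_rpow hD₂ (by norm_num)))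
      _ = K * A ^ (3 / 4 : ℝ) * (M₂ * A + 2 * G) ^ (3 / 4 : ℝ) := by ring
  -- (e) split the power, Young, and `A^{3/2} ≤ A + A³`
  have hsplit : (M₂ * A + 2 * G) ^ (3 / 4 : ℝ) ≤
      M₂ ^ (3 / 4 : ℝ) * A ^ (3 / 4 : ℝ) + (2 : ℝ≥0∞) ^ (3 / 4 : ℝ) * G ^ (3 / 4 : ℝ) := by
    calc (M₂ * A + 2 * G) ^ (3 / 4 : ℝ) ≤ (M₂ * A) ^ (3 / 4 : ℝ) + (2 * G) ^ (3 / 4 : ℝ) :=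
          ENNReal.rpow_add_le_add_rpow _ _ (by norm_num) (by norm_num)
      _ = M₂ ^ (3 / 4 : ℝ) * A ^ (3 / 4 : ℝ) + (2 : ℝ≥0∞) ^ (3 / 4 : ℝ) * G ^ (3 / 4 : ℝ) := by
          rw [ENNReal.mul_rpow_of_nonneg M₂ A (by norm_num), ENNReal.mul_rpow_of_nonneg 2 G (by norm_num)]
  have hAA : A ^ (3 / 4 : ℝ) * A ^ (3 / 4 : ℝ) = A ^ (3 / 2 : ℝ) := by
    rw [← ENNReal.rpow_add_of_nonneg _ _ (by norm_num) (by norm_num)]; norm_num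
  have hterm1 : K * A ^ (3 / 4 : ℝ) * (M₂ ^ (3 / 4 : ℝ) * A ^ (3 / 4 : ℝ)) ≤
      K * M₂ ^ (3 / 4 : ℝ) * (A ^ 3 + A) := by
    calc K * A ^ (3 / 4 : ℝ) * (M₂ ^ (3 / 4 : ℝ) * A ^ (3 / 4 : ℝ))
        = K * M₂ ^ (3 / 4 : ℝ) * (A ^ (3 / 4 : ℝ) * A ^ (3 / 4 : ℝ)) := by ring
      _ = K * M₂ ^ (3 / 4 : ℝ) * A ^ (3 / 2 : ℝ) := by rw [hAA]
      _ ≤ K * M₂ ^ (3 / 4 : ℝ) * (A ^ 3 + A) := by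
          refine mul_le_mul' le_rfl ?_
          rw [add_comm]
          exact rpow_three_halves_le_self_add_pow_three A
  have hterm2 : K * A ^ (3 / 4 : ℝ) * ((2 : ℝ≥0∞) ^ (3 / 4 : ℝ) * G ^ (3 / 4 : ℝ)) ≤
      γ * G + c ^ 4 * (γ⁻¹) ^ 3 * A ^ 3 := by
    calc K * A ^ (3 / 4 : ℝ) * ((2 : ℝ≥0∞) ^ (3 / 4 : ℝ) * G ^ (3 / 4 : ℝ))
        = c * A ^ (3 / 4 : ℝ) * G ^ (3 / 4 : ℝ) := by rw [hc]; ring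
      _ ≤ γ * G + c ^ 4 * (γ⁻¹) ^ 3 * A ^ 3 := mul_rpow_three_quarters_le c A G hγ0 hγt
  calc ∫⁻ x, ‖f x‖ₑ ^ (3 : ℝ)
      ≤ K * A ^ (3 / 4 : ℝ) * (M₂ * A + 2 * G) ^ (3 / 4 : ℝ) := hI
    _ ≤ K * A ^ (3 / 4 : ℝ) *
          (M₂ ^ (3 / 4 : ℝ) * A ^ (3 / 4 : ℝ) + (2 : ℝ≥0∞) ^ (3 / 4 : ℝ) * G ^ (3 / 4 : ℝ)) :=
        mul_le_mul' le_rfl hsplit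
    _ = K * A ^ (3 / 4 : ℝ) * (M₂ ^ (3 / 4 : ℝ) * A ^ (3 / 4 : ℝ)) +
          K * A ^ (3 / 4 : ℝ) * ((2 : ℝ≥0∞) ^ (3 / 4 : ℝ) * G ^ (3 / 4 : ℝ)) := mul_add _ _ _
    _ ≤ K * M₂ ^ (3 / 4 : ℝ) * (A ^ 3 + A) + (γ * G + c ^ 4 * (γ⁻¹) ^ 3 * A ^ 3) :=
        add_le_add hterm1 hterm2
    _ ≤ (K * M₂ ^ (3 / 4 : ℝ) + c ^ 4 * (γ⁻¹) ^ 3) * (A ^ 3 + A) + γ * G := by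
        rw [add_mul]
        have h3 : c ^ 4 * (γ⁻¹) ^ 3 * A ^ 3 ≤ c ^ 4 * (γ⁻¹) ^ 3 * (A ^ 3 + A) :=
          mul_le_mul' le_rfl le_self_add
        calc K * M₂ ^ (3 / 4 : ℝ) * (A ^ 3 + A) + (γ * G + c ^ 4 * (γ⁻¹) ^ 3 * A ^ 3)
            ≤ K * M₂ ^ (3 / 4 : ℝ) * (A ^ 3 + A) + (γ * G + c ^ 4 * (γ⁻¹) ^ 3 * (A ^ 3 + A)) :=
              add_le_add le_rfl (add_le_add le_rfl h3)
          _ = K * M₂ ^ (3 / 4 : ℝ) * (A ^ 3 + A) + c ^ 4 * (γ⁻¹) ^ 3 * (A ^ 3 + A) + γ * G := by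
              ring

end Cutoff

end BradshawTsai2019

end Literature.Analysis.FluidPDE

end
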